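import Summits.QuantumFields.YangMills.Theorems.SmallFieldWideningLargeFieldMassRefinementTailPerFamilyUnitTop
import Summits.QuantumFields.YangMills.Theorems.UnitScaleTiltHistoryTailChessboardT3

/-!
# Route `SmallFieldWidening`, crux r3 `LargeFieldMassRefinementTail` (stmt-QuantumFields-22884): **r3 ⇐ A SEPARATED-FAMILY
# UNIT-TOP LARGE-FIELD ROW** — the «RP-chessboard at unit cells» consumer of the crux record (INTEGRATION gen 28) made kernel
# (support file, width seat `ym-line-sfw-p2-w3` gen 25; conditional certificate — r3, its line and rung R3 stay OPEN; the
# Yang–Mills mass gap is NOT proved by any of this)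

WHAT.  The crux record (lead `ym-line-sfw-p2` gen 28) names, on paper only, a second consumer of Bałaban's terminal densities for
r3: «`UnitTopSummable ⇐ RP-chessboard(unit cells) + GlobalTerminalLargeFieldBound + GlobalLowerBound(5)`» — reflection positivity
localises a GLOBAL (thermodynamic) large-field bound to one unit plaquette.  The reflection-positivity half of that consumer is
ALREADY a tree theorem, for every height, in the currency of route `UnitScaleTilt`'s crux K2:
`HistoryTailChessboardT3.chessboardRP_T3` (fleet `ym-ust-18916`, 2026-08-27; cells of side `L^s ≥ ρ + 4` unit blocks, so the
`2 × 2 × 1`-block footprint of an averaged plaquette never straddles a cell wall and the cell count `2L^{m−s}` per direction is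
even): for every `ρ ≥ 1` and every plaquette `p` of the `j`-fold averaged field there is a finite family `S ∋ p` of plaquettes,
pairwise `ρ`-separated (`ℓ¹` torus distance of base points), with `sitesPerDir(j)³ ≤ |S|·8(L(ρ+4))³` and
`Gibbs_K{θ ≤ |Ū^j(∂p) − 1|} ≤ Gibbs_K{∀ q ∈ S, θ ≤ |Ū^j(∂q) − 1|}^{1/|S|}`.  THIS FILE draws the corollary for r3 at the
unit top `j = K` of the deep refinements, through the landed per-family door
`LargeFieldMassRefinementTailPerFamilyUnitTop.largeFieldMassRefinementTail_of_unitTopFam` (p-family, one profile per `L`):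

* §1 `exists_forall_rpow_sub_rpow_le` — the budget: `C₁x^a − κx^b` is bounded above on `[1, ∞)` for `0 ≤ a < b`, `κ > 0`
  (pure real analysis; the shape of `stub_budget` of K2's line card).
* §2 ★ **`largeFieldMassRefinementTail_of_separatedUnitRow`** — r3 BY NAME from the SEPARATED-FAMILY UNIT-TOP ROW: for every block
  size `L` a profile `(b₀, p₀)` and separation exponents `r, R ≥ 0` with `3r + 1 < 2p₀` such that every family `F` (`F.L = L`) at
  every `γ > 0` has `n₁, N, A ≥ 1, c > 0` with, for every depth `d ≥ n₁`, every run `K ≥ 2` of `F.refine d` at `γ_d = γL^{−d}` and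
  every finite set `S` of UNIT plaquettes pairwise `(1 + R·x_d^r)`-separated, `x_d = 1 + log(√γ_d)⁻¹` (Bałaban's logarithmic unit
  of (7), a collar-sized separation is allowed):
  `Gibbs_{K}(∀ q ∈ S, θ_{γ_d}(0) ≤ |Ū^K(∂q) − 1|) ≤ (A·γ_d^{−N})^{sitesPerDir(K)³} · exp(−c·p(√γ_d)²·|S|)`
  — an extensive ignorance factor per unit site (the gap between two-sided free-energy bounds, [Balaban1985UV3] Thm 1 (5))
  times the small factor `e^{−c p²}` per member (the terminal large-field factors (70)–(71) for a separated family).  Proof: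
  chessboard with `ρ_d = 1 + R x_d^r`, the `|S|`-th root turns the row into `(Aγ_d^{−N})^{8(L(ρ_d+4))³}·e^{−cp²}`, and the budget
  absorbs the prefactor `exp(O(x_d^{3r+1}))` into `e^{−(c/2)p²}` (`p² = b₀²x_d^{2p₀}`, `2p₀ > 3r + 1`).

WHY THIS DOOR (and what it is NOT).  Every other certificate for stmt-QuantumFields-22884 reduces r3 to a LOCAL probabilistic
statement (per-plaquette tails, one-step event comparisons `stub_localStepFloor`, per-history density ratios); this one reads a
GLOBAL row — the natural output of two-sided UV-stable free-energy bounds with large-field factors — and lets reflection positivity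
do the localisation.  The row is a HYPOTHESIS (not printed as a probability statement; not claimed); nothing of Bałaban's
estimates is proved here; no summit statement is touched (rung R3 `YM3TorusSU2` is a RECORD rung; the Yang–Mills mass gap is NOT
proved by any of this).

References: J. Fröhlich, R. Israel, E. Lieb, B. Simon, CMP **62** (1978) 1–34 [FrohlichIsraelLiebSimon1978] Thm. 4.1 (chessboard);
T. Bałaban, CMP **102** (1985) 255–275 [Balaban1985UV3] ((5) p.256, (7) p.257, (41) p.266, (70)–(71) p.273).
-/

noncomputable section

open MeasureTheory Finset
open Literature.MathematicalPhysics.QuantumFieldTheory.Balaban1983to89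
open Literature.MathematicalPhysics.QuantumFieldTheory.Balaban1983to89.T3ContinuumYM3Torus
open Literature.MathematicalPhysics.QuantumFieldTheory.Balaban1983to89.T3UnitScaleTilt
open Literature.MathematicalPhysics.QuantumFieldTheory.Balaban1983to89.T3UnitLawDensityEML (ℰp measurableE_ℰp)
open Summit.QuantumFields.YangMills.Theorems.LargeFieldMassRefinementTailPerFamilyUnitTop
  (largeFieldMassRefinementTail_of_unitTopFam)
open Summit.QuantumFields.YangMills.Theorems.HistoryTailChessboardT3 (chessboardRP_T3)

namespace Summit.QuantumFields.YangMills.Theorems.LargeFieldMassRefinementTailOfSeparatedUnitRow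

/-! ## §1 The budget: a smaller power is absorbed by a larger one -/

/-- **BUDGET.**  For `0 ≤ a < b`, `0 ≤ C₁` and `κ > 0` there is `C₂ ≥ 0` with `C₁·x^a − κ·x^b ≤ C₂` for all `x ≥ 1` (beyond
`X = max(1, (C₁/κ)^{1/(b−a)})` the expression is `≤ 0`, before it is `≤ C₁X^a`).  [folklore] -/
theorem exists_forall_rpow_sub_rpow_le {a b C₁ κ : ℝ} (ha : 0 ≤ a) (hab : a < b) (hC₁ : 0 ≤ C₁) (hκ : 0 < κ) :
    ∃ C₂ : ℝ, 0 ≤ C₂ ∧ ∀ x : ℝ, 1 ≤ x → C₁ * x ^ a - κ * x ^ b ≤ C₂ := by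
  set X₁ : ℝ := max 1 ((C₁ / κ) ^ (1 / (b - a))) with hX₁
  have hX₁1 : 1 ≤ X₁ := le_max_left _ _
  have hX₁0 : 0 < X₁ := lt_of_lt_of_le one_pos hX₁1
  refine ⟨C₁ * X₁ ^ a, mul_nonneg hC₁ (Real.rpow_nonneg hX₁0.le a), fun x hx => ?_⟩
  have hx0 : 0 < x := lt_of_lt_of_le one_pos hx
  have hba : 0 < b - a := sub_pos.mpr hab
  by_cases hcase : C₁ ≤ κ * x ^ (b - a)
  · -- the negative term dominates
    have h1 : C₁ * x ^ a ≤ κ * x ^ b := by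
      have e : x ^ b = x ^ (b - a) * x ^ a := by
        rw [← Real.rpow_add hx0]; congr 1; ring
      rw [e, ← mul_assoc]
      exact mul_le_mul_of_nonneg_right hcase (Real.rpow_nonneg hx0.le a)
    have h2 : 0 ≤ C₁ * X₁ ^ a := mul_nonneg hC₁ (Real.rpow_nonneg hX₁0.le a)
    linarith
  · -- `x` is below `X₁`
    rw [not_le] at hcase
    have hxlt : x ^ (b - a) < C₁ / κ := by
      rw [lt_div_iff₀ hκ]; linarith
    have hxX : x ≤ X₁ := by
      have h3 : x = (x ^ (b - a)) ^ (1 / (b - a)) := by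
        rw [← Real.rpow_mul hx0.le, mul_one_div_cancel hba.ne', Real.rpow_one]
      have h4 : (x ^ (b - a)) ^ (1 / (b - a)) ≤ (C₁ / κ) ^ (1 / (b - a)) :=
        Real.rpow_le_rpow (Real.rpow_nonneg hx0.le _) hxlt.le (by positivity)
      calc x = (x ^ (b - a)) ^ (1 / (b - a)) := h3
        _ ≤ (C₁ / κ) ^ (1 / (b - a)) := h4
        _ ≤ X₁ := le_max_right _ _
    have h5 : x ^ a ≤ X₁ ^ a := Real.rpow_le_rpow hx0.le hxX ha
    have h6 : 0 ≤ κ * x ^ b := mul_nonneg hκ.le (Real.rpow_nonneg hx0.le b)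
    nlinarith [mul_le_mul_of_nonneg_left h5 hC₁]

/-! ## §2 r3 from the separated-family unit-top row -/

/-- Eventually `γ·L^{−d} ≤ 1` (`L ≥ 2`). [folklore] -/
theorem exists_forall_coupling_le_one {L : ℕ} (hL : 1 < L) {γ : ℝ} (hγ : 0 < γ) :
    ∃ n₂ : ℕ, ∀ d : ℕ, n₂ ≤ d → γ * ((L : ℝ)⁻¹) ^ d ≤ 1 := by
  have hL1 : (1 : ℝ) < L := by exact_mod_cast hL
  have hq0 : (0 : ℝ) ≤ (L : ℝ)⁻¹ := inv_nonneg.mpr (by linarith)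
  have hq1 : ((L : ℝ)⁻¹) < 1 := inv_lt_one_of_one_lt₀ hL1
  obtain ⟨n₂, hn₂⟩ := exists_pow_lt_of_lt_one (inv_pos.mpr hγ) hq1
  refine ⟨n₂, fun d hd => ?_⟩
  have hmono : ((L : ℝ)⁻¹) ^ d ≤ ((L : ℝ)⁻¹) ^ n₂ := pow_le_pow_of_le_one hq0 hq1.le hd
  have h1 : γ * ((L : ℝ)⁻¹) ^ d ≤ γ * ((L : ℝ)⁻¹) ^ n₂ := mul_le_mul_of_nonneg_left hmono hγ.le
  have h2 : γ * ((L : ℝ)⁻¹) ^ n₂ < γ * γ⁻¹ := mul_lt_mul_of_pos_left hn₂ hγ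
  rw [mul_inv_cancel₀ hγ.ne'] at h2
  linarith

/-- ★ **r3 `LargeFieldMassRefinementTail` ⇐ THE SEPARATED-FAMILY UNIT-TOP LARGE-FIELD ROW** (stmt-QuantumFields-22884 BY NAME).
The row (hypothesis `hRow`, supplier-facing, NOT claimed): for every `L` a profile `0 < b₀`, `2 < p₀` and `r, R ≥ 0` with
`3r + 1 < 2p₀` such that for every family `F` (`F.L = L`) and `γ > 0` there are `n₁, N`, `A ≥ 1`, `c > 0` with, for every depth
`d ≥ n₁`, run `K ≥ 2` of `F.refine d` at `γ_d = γL^{−d}`, and finite set `S` of unit plaquettes pairwise `(1 + R·x_d^r)`-separated in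
the `ℓ¹` torus distance of base points (`x_d = 1 + log(√γ_d)⁻¹`):
`Gibbs_K(F.refine d, γ_d){∀ q ∈ S, θBal_{γ_d}(0) ≤ |Ū^K(∂q) − 1|} ≤ (A·γ_d^{−N})^{sitesPerDir(K)³}·exp(−c·p_{b₀}(√γ_d)²·|S|)`.
Proof: the landed chessboard `chessboardRP_T3` at the unit top (`j = K`) of `F.refine d` with `ρ_d = 1 + R x_d^r`, the `|S|`-th root,
`sitesPerDir³/|S| ≤ 8(L(ρ_d+4))³ ≤ 8L³(5+R)³x_d^{3r}`, `log(Aγ_d^{−N}) ≤ (log A + 2N)x_d`, the budget of §1 with `a = 3r + 1 < b = 2p₀`,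
then the per-family door `largeFieldMassRefinementTail_of_unitTopFam` with constants `(e^{C₂}, N = 0, c/2)` (the small sub-unit history
of the door's event is dropped by monotonicity).  Conditional certificate; nothing about the mass gap.
[cite: FrohlichIsraelLiebSimon1978, Thm. 4.1; Balaban1985UV3, (5) p.256 and (70)-(71) p.273] -/
theorem largeFieldMassRefinementTail_of_separatedUnitRow
    (hRow : ∀ L : ℕ, ∃ (b₀ p₀ r R : ℝ), 0 < b₀ ∧ 2 < p₀ ∧ 0 ≤ r ∧ 0 ≤ R ∧ 3 * r + 1 < 2 * p₀ ∧
      ∀ (F : T3Family) (γ : ℝ), F.L = L → 0 < γ →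
        ∃ (n₁ N : ℕ) (A c : ℝ), 1 ≤ A ∧ 0 < c ∧ ∀ d : ℕ, n₁ ≤ d → ∀ K : ℕ, 2 ≤ K →
          ∀ S : Finset (Plaq ((F.refine d).P K) K),
            (∀ q ∈ S, ∀ q' ∈ S, q ≠ q' →
              1 + R * (1 + Real.log (Real.sqrt (γ * ((F.L : ℝ)⁻¹) ^ d))⁻¹) ^ r ≤ (Site.tdist q.src q'.src : ℝ)) →
            (gibbsK (F.refine d) ℰp (γ * ((F.L : ℝ)⁻¹) ^ d) K).real
                {V | ∀ q ∈ S, θBal F.L (γ * ((F.L : ℝ)⁻¹) ^ d) b₀ p₀ 0 ≤ GaugeGroup.dist1 (GaugeField.plaqHol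
                    (Averaging.iter (fun i => BlockAveraging.blockAvg (P := (F.refine d).P K) (j := i) ℰp) K V) q)} ≤
              (A * ((γ * ((F.L : ℝ)⁻¹) ^ d)⁻¹) ^ N) ^ (((F.refine d).P K).sitesPerDir K ^ 3) *
                Real.exp (-(c * B10.pFun b₀ p₀ (Real.sqrt (γ * ((F.L : ℝ)⁻¹) ^ d)) ^ 2 * S.card))) :
    Summit.QuantumFields.YangMills.Theses.SmallFieldWidening.LargeFieldMassRefinementTail := by
  refine largeFieldMassRefinementTail_of_unitTopFam fun L => ?_
  obtain ⟨b₀, p₀, r, R, hb₀, hp₀, hr, hR, hrp, hfam⟩ := hRow L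
  clear hRow
  refine ⟨b₀, p₀, hb₀, hp₀, fun F γ hFL hγ => ?_⟩
  obtain ⟨n₁, N, A, c, hA, hc, hrow⟩ := hfam F γ hFL hγ
  clear hfam
  subst hFL
  have hLodd : Odd F.L := F.hL.1
  have hL1 : 1 < F.L := F.hL.2
  have hLR : (1 : ℝ) < (F.L : ℝ) := by exact_mod_cast hL1
  have hL0 : (0 : ℝ) < (F.L : ℝ) := by linarith
  -- the budget constants (independent of the depth `d`)
  have hlogA : 0 ≤ Real.log A := Real.log_nonneg hA
  have hC₁0 : 0 ≤ 8 * (F.L : ℝ) ^ 3 * (5 + R) ^ 3 * (Real.log A + 2 * N) := by positivity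
  have hκ : 0 < c * b₀ ^ 2 / 2 := by positivity
  obtain ⟨C₂, hC₂, hbudget⟩ :=
    exists_forall_rpow_sub_rpow_le (a := 3 * r + 1) (b := 2 * p₀)
      (C₁ := 8 * (F.L : ℝ) ^ 3 * (5 + R) ^ 3 * (Real.log A + 2 * N)) (by linarith) hrp hC₁0 hκ
  -- the depth beyond which `γ_d ≤ 1`
  obtain ⟨n₂, hn₂⟩ := exists_forall_coupling_le_one hL1 hγ
  refine ⟨max n₁ n₂, 0, Real.exp C₂, c / 2, half_pos hc, fun d hd K hK p => ?_⟩
  have hd₁ : n₁ ≤ d := le_trans (le_max_left _ _) hd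
  have hd₂ : n₂ ≤ d := le_trans (le_max_right _ _) hd
  have hrowd := hrow d hd₁ K hK
  have hγd1 := hn₂ d hd₂
  clear hrow hn₂
  have hγd : 0 < γ * ((F.L : ℝ)⁻¹) ^ d := mul_pos hγ (pow_pos (inv_pos.mpr hL0) d)
  -- the coupling at depth `d`, made opaque
  generalize γ * ((F.L : ℝ)⁻¹) ^ d = γd at hrowd hγd1 hγd ⊢
  have hsq : 0 < Real.sqrt γd := Real.sqrt_pos.mpr hγd
  have hsq1 : Real.sqrt γd ≤ 1 := (Real.sqrt_le_sqrt hγd1).trans_eq Real.sqrt_one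
  -- the logarithmic unit `x = 1 + log (√γ_d)⁻¹` and the separation `ρ = 1 + R x^r`
  obtain ⟨x, hx_def⟩ : ∃ x : ℝ, x = 1 + Real.log (Real.sqrt γd)⁻¹ := ⟨_, rfl⟩
  have hx : 1 ≤ x := by
    rw [hx_def]
    have : 0 ≤ Real.log (Real.sqrt γd)⁻¹ := Real.log_nonneg ((one_le_inv₀ hsq).mpr hsq1)
    linarith
  have hx0 : 0 < x := lt_of_lt_of_le one_pos hx
  have hxr : 1 ≤ x ^ r := Real.one_le_rpow hx hr
  obtain ⟨ρ, hρ_def⟩ : ∃ ρ : ℝ, ρ = 1 + R * x ^ r := ⟨_, rfl⟩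
  have hρ : 1 ≤ ρ := by rw [hρ_def]; nlinarith
  -- the chessboard at the unit top of `F.refine d`
  obtain ⟨S, hpS, hsep, hdense, hcb⟩ :=
    chessboardRP_T3 F.L hLodd hL1 (F.refine d) γd rfl hγd hγd1 (θBal F.L γd b₀ p₀ 0) K K le_rfl ρ hρ p
  have hS : 0 < S.card := Finset.card_pos.mpr ⟨p, hpS⟩
  have hs : (0 : ℝ) < (S.card : ℝ) := by exact_mod_cast hS
  -- the row at `S`
  have hrowS := hrowd S (fun q hq q' hq' hne => by
    rw [← hx_def, ← hρ_def]; exact hsep q hq q' hq' hne)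
  clear hrowd hsep
  -- the measure is a probability measure
  haveI := isProbabilityMeasure_gibbsK (F.refine d) ℰp hγd.le K
  -- opaque abbreviations: the ignorance base `B`, the volume `V`, the exponent `P2`, the density `D`
  obtain ⟨B, hB_def⟩ : ∃ B : ℝ, B = A * (γd⁻¹) ^ N := ⟨_, rfl⟩
  obtain ⟨V, hV_def⟩ : ∃ V : ℕ, V = ((F.refine d).P K).sitesPerDir K ^ 3 := ⟨_, rfl⟩
  obtain ⟨P2, hP2_def⟩ : ∃ P2 : ℝ, P2 = B10.pFun b₀ p₀ (Real.sqrt γd) ^ 2 := ⟨_, rfl⟩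
  obtain ⟨D, hD_def⟩ : ∃ D : ℝ, D = 8 * ((F.L : ℝ) * (ρ + 4)) ^ 3 := ⟨_, rfl⟩
  rw [← hB_def, ← hV_def, ← hP2_def] at hrowS
  rw [← hP2_def]
  have hγdinv : 1 ≤ γd⁻¹ := (one_le_inv₀ hγd).mpr hγd1
  have hB1 : 1 ≤ B := by
    rw [hB_def]
    exact one_le_mul_of_one_le_of_one_le hA (one_le_pow₀ hγdinv)
  have hB0 : 0 < B := lt_of_lt_of_le one_pos hB1
  have hD0 : 0 ≤ D := by rw [hD_def]; positivity
  -- (1) drop the sub-unit history and apply the chessboard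
  have step1 : (gibbsK (F.refine d) ℰp γd K).real
      {V' | (∀ k, k < K → PlaqSmall (θBal F.L γd b₀ p₀ (K - k))
          (Averaging.iter (fun i => BlockAveraging.blockAvg (P := (F.refine d).P K) (j := i) ℰp) k V')) ∧
        θBal F.L γd b₀ p₀ 0 ≤ GaugeGroup.dist1 (GaugeField.plaqHol
          (Averaging.iter (fun i => BlockAveraging.blockAvg (P := (F.refine d).P K) (j := i) ℰp) K V') p)} ≤
      ((gibbsK (F.refine d) ℰp γd K).real
        {U | ∀ q ∈ S, θBal F.L γd b₀ p₀ 0 ≤ GaugeGroup.dist1 (GaugeField.plaqHol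
          (Averaging.iter (fun i => BlockAveraging.blockAvg (P := (F.refine d).P K) (j := i) ℰp) K U) q)}) ^
        ((1 : ℝ) / (S.card : ℝ)) :=
    le_trans (measureReal_mono (fun U hU => hU.2) (measure_ne_top _ _)) hcb
  -- (2) the row, under the root
  have step2 : ((gibbsK (F.refine d) ℰp γd K).real
        {U | ∀ q ∈ S, θBal F.L γd b₀ p₀ 0 ≤ GaugeGroup.dist1 (GaugeField.plaqHol
          (Averaging.iter (fun i => BlockAveraging.blockAvg (P := (F.refine d).P K) (j := i) ℰp) K U) q)}) ^
        ((1 : ℝ) / (S.card : ℝ)) ≤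
      ((B ^ V) * Real.exp (-(c * P2 * S.card))) ^ ((1 : ℝ) / (S.card : ℝ)) :=
    Real.rpow_le_rpow measureReal_nonneg hrowS (by positivity)
  -- (3) algebra of the root
  have step3 : ((B ^ V) * Real.exp (-(c * P2 * S.card))) ^ ((1 : ℝ) / (S.card : ℝ)) =
      B ^ ((V : ℝ) / (S.card : ℝ)) * Real.exp (-(c * P2)) := by
    rw [Real.mul_rpow (pow_nonneg hB0.le _) (Real.exp_nonneg _), ← Real.rpow_natCast, ← Real.rpow_mul hB0.le,
      ← Real.exp_mul]
    have e : -(c * P2 * (S.card : ℝ)) * ((1 : ℝ) / (S.card : ℝ)) = -(c * P2) := by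
      field_simp
    rw [mul_one_div, e]
  -- (4) the density: `V / |S| ≤ D`
  have hdense' : ((V : ℕ) : ℝ) ≤ (S.card : ℝ) * D := by
    rw [hV_def, Nat.cast_pow, hD_def]
    exact hdense
  have hVD : (V : ℝ) / (S.card : ℝ) ≤ D := by
    rw [div_le_iff₀ hs, mul_comm]
    exact hdense'
  have step4 : B ^ ((V : ℝ) / (S.card : ℝ)) ≤ B ^ D := Real.rpow_le_rpow_of_exponent_le hB1 hVD
  -- (5) the budget: `B^D · e^{−cP²} ≤ e^{C₂} · e^{−(c/2)P²}`
  have hlogγ : Real.log γd⁻¹ = 2 * (x - 1) := by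
    rw [hx_def, Real.log_inv, Real.log_inv, Real.log_sqrt hγd.le]; ring
  have hlogB : Real.log B ≤ (Real.log A + 2 * N) * x := by
    rw [hB_def, Real.log_mul (by positivity) (by positivity), Real.log_pow, hlogγ]
    have hN0 : (0 : ℝ) ≤ N := Nat.cast_nonneg N
    have h1 : Real.log A ≤ Real.log A * x := le_mul_of_one_le_right hlogA hx
    have h2 : (N : ℝ) * (2 * (x - 1)) ≤ 2 * N * x := by nlinarith
    linarith
  have hlogB0 : 0 ≤ Real.log B := Real.log_nonneg hB1
  have hρ4 : ρ + 4 ≤ (5 + R) * x ^ r := by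
    have e : (5 + R) * x ^ r = 5 * x ^ r + R * x ^ r := by ring
    rw [hρ_def, e]; linarith [hxr]
  have hx3 : (x ^ r) ^ (3 : ℕ) = x ^ (3 * r) := by
    rw [← Real.rpow_natCast, ← Real.rpow_mul hx0.le]; congr 1; push_cast; ring
  have hD : D ≤ 8 * (F.L : ℝ) ^ 3 * (5 + R) ^ 3 * x ^ (3 * r) := by
    rw [hD_def]
    have h1 : ((F.L : ℝ) * (ρ + 4)) ^ 3 ≤ ((F.L : ℝ) * ((5 + R) * x ^ r)) ^ 3 :=
      pow_le_pow_left₀ (by positivity) (mul_le_mul_of_nonneg_left hρ4 hL0.le) 3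
    have h2 : ((F.L : ℝ) * ((5 + R) * x ^ r)) ^ 3 = (F.L : ℝ) ^ 3 * (5 + R) ^ 3 * x ^ (3 * r) := by
      rw [mul_pow, mul_pow, hx3]; ring
    linarith
  have hDlogB : D * Real.log B ≤ 8 * (F.L : ℝ) ^ 3 * (5 + R) ^ 3 * (Real.log A + 2 * N) * x ^ (3 * r + 1) := by
    calc D * Real.log B ≤ (8 * (F.L : ℝ) ^ 3 * (5 + R) ^ 3 * x ^ (3 * r)) * ((Real.log A + 2 * N) * x) :=
          mul_le_mul hD hlogB hlogB0 (by positivity)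
      _ = 8 * (F.L : ℝ) ^ 3 * (5 + R) ^ 3 * (Real.log A + 2 * N) * x ^ (3 * r + 1) := by
          rw [Real.rpow_add hx0, Real.rpow_one]; ring
  have hx2 : (x ^ p₀) ^ (2 : ℕ) = x ^ (2 * p₀) := by
    rw [← Real.rpow_natCast, ← Real.rpow_mul hx0.le]; congr 1; push_cast; ring
  have hP2 : P2 = b₀ ^ 2 * x ^ (2 * p₀) := by
    rw [hP2_def, B10LargeField.pFun_eq]
    unfold B10LargeField.xlog
    rw [← hx_def, mul_pow, hx2]
  have hbud := hbudget x hx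
  have step5 : B ^ D * Real.exp (-(c * P2)) ≤ Real.exp C₂ * Real.exp (-(c / 2 * P2)) := by
    rw [Real.rpow_def_of_pos hB0, ← Real.exp_add, ← Real.exp_add]
    refine Real.exp_le_exp.mpr ?_
    rw [hP2, mul_comm (Real.log B) D]
    have h3 : c * (b₀ ^ 2 * x ^ (2 * p₀)) = 2 * (c * b₀ ^ 2 / 2 * x ^ (2 * p₀)) := by ring
    have h4 : c / 2 * (b₀ ^ 2 * x ^ (2 * p₀)) = c * b₀ ^ 2 / 2 * x ^ (2 * p₀) := by ring
    rw [h3, h4]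
    linarith [hDlogB, hbud]
  -- assemble
  have hfin : B ^ ((V : ℝ) / (S.card : ℝ)) * Real.exp (-(c * P2)) ≤ Real.exp C₂ * Real.exp (-(c / 2 * P2)) :=
    le_trans (mul_le_mul_of_nonneg_right step4 (Real.exp_nonneg _)) step5
  have hall := step1.trans (step2.trans (step3.le.trans hfin))
  rw [pow_zero, mul_one]
  exact hall

end Summit.QuantumFields.YangMills.Theorems.LargeFieldMassRefinementTailOfSeparatedUnitRow

end
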